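import Summits.QuantumFields.YangMills.Theorems.UnitScaleTiltHistoryTailCornerBlocks

/-!
# Route `UnitScaleTilt` — crux K2-L `HistoryTailL` (stmt-QuantumFields-19936), STUB 4c `stub_diluteExponent`: COUNTING THE LARGE-FIELD REGIONS' VOLUME
# BY THE LARGE-FIELD PLAQUETTES — the level-`i` sites whose representative lies outside `Ω_{i+1}(h)` of the LANE's regions number at most
# `Σ_{l ≤ i} #P_l(h)·(2(2d·ρ_i/L^i) + 1)^d`, `ρ_i` = the reach of the collar chain + a plaquette-cover diameter (support file; the «|Z_i| ≤ Σ (c R(g) M₁)³ per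
# large plaquette» bookkeeping behind the entropy/`Zterm` charges `Σ_i #P_i·σ(i,j)` of the dilute-family exponent bound)

Fleet lead `ym-ust-18916-p1` (gen 3), 2026-08-27.  Inputs: `HistoryTailLaneTowerReach.exists_source_within_reach` (p489534), `Run3Collar.Omega_castLE` /
`tdist_src_le_of_mem_plaqCover` (lane p2), `HistoryTailTowerReach.ncard_levelSites_near_le` (p484215).

* §1 `tdist_le_of_mem_plaqCover_toFine` (a covered fine site is within `(2 + d)·L^l` of the plaquette's representative `toFine l p.src`);
* §2 `card_filter_le_of_cover` (abstract count: sites whose representative is within `ρ` of the representative of some plaquette of the lists `P_l`, `l ≤ i`);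
* §3 **`card_outside_Omega_succ_le`** — for `h : Hist P j`, `i + 1 ≤ j`: `#{y : T^{(i)} | toFine i y ∉ Ω_{i+1}(h)} ≤ Σ_{l ≤ i} #P_l(h)·(2(2d·ρ/L^i) + 1)^d` for every
  natural `ρ ≥ 3(R₁(max 1 r₀)^{r₀}M₁x_i^{r₀} + M₁ + d + dM₁L)·L^i + (2 + d)·L^i` (collars along the flow, `i ≤ K`).

References: T. Bałaban, CMP 102 (1985) 255–275 [Balaban1985UV3] ((39), (41) p.266; p.268).
-/

noncomputable section

open scoped BigOperators

namespace Summit.QuantumFields.YangMills.Theorems.HistoryTailZCount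

open Literature.MathematicalPhysics.QuantumFieldTheory.Balaban1983to89
open B10LargeField (xlog)
open B10Eq38TorusDomains (toFine toFine_succ)
open Summit.QuantumFields.Balaban3D.Carriers
open Summit.QuantumFields.Balaban3D.Proofs.Run3Collar (Omega_castLE tdist_src_le_of_mem_plaqCover)
open B3Taylor310LocalRemainder (tdist_comm tdist_triangle)
open Summit.QuantumFields.YangMills.Theorems (coarsen_toFine)
open Summit.QuantumFields.YangMills.Theorems.HistoryTailTowerReach (ncard_levelSites_near_le)
open Summit.QuantumFields.YangMills.Theorems.HistoryTailLaneTowerReach (tdist_add_le_pow_mul_sdist exists_source_within_reach)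

variable {P : Params}

/-! ## §1 A covered site is near the plaquette's representative -/

/-- A fine site covered by a level-`l` plaquette is within `(2 + d)·L^l` fine steps of the representative `toFine l p.src`. [cite: Balaban1985UV3, (38) p.266] -/
theorem tdist_le_of_mem_plaqCover_toFine {l : ℕ} (hl : l ≤ P.m + P.K) {p : Plaq P l} {c : Site P 0} (hc : c ∈ plaqCover p) :
    (Site.tdist c (toFine l p.src) : ℝ) ≤ (2 + P.d) * (P.L : ℝ) ^ l := by
  have h1 := tdist_add_le_pow_mul_sdist l hl c (toFine l p.src)
  have h2 : sdist l c (toFine l p.src) ≤ 2 := by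
    unfold sdist
    rw [coarsen_toFine l hl, tdist_comm]
    exact tdist_src_le_of_mem_plaqCover hc
  have h3 : Site.tdist c (toFine l p.src) ≤ P.L ^ l * 2 + P.d * P.L ^ l := by
    have := Nat.mul_le_mul_left (P.L ^ l) h2
    omega
  have h4 : (Site.tdist c (toFine l p.src) : ℝ) ≤ ((P.L ^ l * 2 + P.d * P.L ^ l : ℕ) : ℝ) := by exact_mod_cast h3
  refine h4.trans (le_of_eq ?_)
  push_cast; ring

/-! ## §2 The abstract count -/

open Classical in
/-- **COUNT BY COVER**: if every level-`i` site of a set has its representative within `ρ` of the representative of a plaquette of one of the finite sets `Q l`,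
`l ≤ i`, the set has at most `Σ_{l ≤ i} #(Q l)·(2(2dρ/L^i) + 1)^d` sites. [cite: Balaban1985UV3, (39) p.266] -/
theorem card_filter_le_of_cover {i : ℕ} (hi : i ≤ P.m + P.K) (Q : (l : ℕ) → Finset (Plaq P l)) (S : Finset (Site P i)) (ρ : ℕ)
    (hcover : ∀ y ∈ S, ∃ l, l ≤ i ∧ ∃ p ∈ Q l, Site.tdist (toFine i y) (toFine l p.src) ≤ ρ) :
    S.card ≤ ∑ l ∈ Finset.range (i + 1), (Q l).card * (2 * (2 * P.d * ρ / P.L ^ i) + 1) ^ P.d := by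
  set near : (l : ℕ) → Plaq P l → Finset (Site P i) := fun l p => Finset.univ.filter fun y => Site.tdist (toFine i y) (toFine l p.src) ≤ ρ with hnear
  have hsub : S ⊆ (Finset.range (i + 1)).biUnion fun l => (Q l).biUnion fun p => near l p := by
    intro y hy
    obtain ⟨l, hl, p, hp, hd⟩ := hcover y hy
    simp only [Finset.mem_biUnion, Finset.mem_range]
    exact ⟨l, by omega, p, hp, by rw [hnear]; simpa using hd⟩
  have hnear_card : ∀ l (p : Plaq P l), (near l p).card ≤ (2 * (2 * P.d * ρ / P.L ^ i) + 1) ^ P.d := by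
    intro l p
    have h := ncard_levelSites_near_le hi (toFine l p.src) ρ
    have heq : ({x : Site P i | Site.tdist (toFine i x) (toFine l p.src) ≤ ρ} : Set (Site P i)).ncard = (near l p).card := by
      rw [hnear, Set.ncard_eq_toFinset_card', Set.toFinset_setOf]
    rwa [heq] at h
  calc S.card ≤ ((Finset.range (i + 1)).biUnion fun l => (Q l).biUnion fun p => near l p).card := Finset.card_le_card hsub
    _ ≤ ∑ l ∈ Finset.range (i + 1), ((Q l).biUnion fun p => near l p).card := Finset.card_biUnion_le
    _ ≤ ∑ l ∈ Finset.range (i + 1), ∑ p ∈ Q l, (near l p).card := Finset.sum_le_sum fun l _ => Finset.card_biUnion_le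
    _ ≤ ∑ l ∈ Finset.range (i + 1), ∑ _p ∈ Q l, (2 * (2 * P.d * ρ / P.L ^ i) + 1) ^ P.d :=
        Finset.sum_le_sum fun l _ => Finset.sum_le_sum fun p _ => hnear_card l p
    _ = ∑ l ∈ Finset.range (i + 1), (Q l).card * (2 * (2 * P.d * ρ / P.L ^ i) + 1) ^ P.d := by
        refine Finset.sum_congr rfl fun l _ => ?_
        rw [Finset.sum_const, smul_eq_mul]

/-! ## §3 The volume outside `Ω_{i+1}(h)` at level `i` -/

open Classical in
/-- **THE LEVEL-`i` VOLUME OUTSIDE `Ω_{i+1}(h)` IS CONTROLLED BY THE LARGE-FIELD PLAQUETTES OF THE PASSAGES `l ≤ i`**: for a region history `h` of length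
`j ≥ i + 1` of the lane's regions with collars `Rcol_l ≤ (R₁x_l^{r₀} + 1)M₁` along the flow (`l ≤ i ≤ K`), every natural `ρ` exceeding the reach
`3(R₁(max 1 r₀)^{r₀}M₁x_i^{r₀} + M₁ + d + dM₁L)·L^i` plus the cover diameter `(2 + d)L^i` bounds
`#{y : T^{(i)} | toFine i y ∉ Ω_{i+1}(h)} ≤ Σ_{l ≤ i} #P_l(h)·(2(2dρ/L^i) + 1)^d`. [cite: Balaban1985UV3, (39) and (41) p.266] -/
theorem card_outside_Omega_succ_le {γ : ℝ} (hγ : 0 < γ) (hγ1 : γ ≤ 1) {M₁ : ℕ} (hM : 0 < M₁) {R₁ r₀ : ℝ} (hR : 0 ≤ R₁) (hr : 0 ≤ r₀)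
    (Rcol : ℕ → ℕ) {i j K : ℕ} (hij : i + 1 ≤ j) (hiK : i ≤ K) (hi : i + 1 ≤ P.m + P.K)
    (hRcol : ∀ l, l ≤ i → (Rcol l : ℝ) ≤ (R₁ * xlog (Real.sqrt (γ * ((P.L : ℝ)⁻¹) ^ (K - l))) ^ r₀ + 1) * M₁)
    (h : Hist P j) (ρ : ℕ)
    (hρ : 3 * ((R₁ * (max 1 r₀) ^ r₀ * M₁ * xlog (Real.sqrt (γ * ((P.L : ℝ)⁻¹) ^ (K - i))) ^ r₀ + M₁ + P.d + P.d * M₁ * P.L) * (P.L : ℝ) ^ i) +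
      (2 + P.d) * (P.L : ℝ) ^ i ≤ ρ) :
    (Finset.univ.filter fun y : Site P i => toFine i y ∉ Omega M₁ Rcol j h (i + 1)).card ≤
      ∑ l ∈ Finset.range (i + 1),
        (if hl : l < j then h ⟨l, hl⟩ else (∅ : Finset (Plaq P l))).card * (2 * (2 * P.d * ρ / P.L ^ i) + 1) ^ P.d := by
  refine card_filter_le_of_cover (by omega) (fun l => if hl : l < j then h ⟨l, hl⟩ else (∅ : Finset (Plaq P l))) _ ρ fun y hy => ?_
  rw [Finset.mem_filter] at hy
  have hy' : toFine i y ∉ Omega M₁ Rcol (i + 1) (fun l => h (Fin.castLE hij l)) (i + 1) := by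
    rw [← Omega_castLE M₁ Rcol j h (i + 1) hij]; exact hy.2
  obtain ⟨l, hl, p, hp, c, hc, hd⟩ := exists_source_within_reach hγ hγ1 hM hR hr hiK hi Rcol hRcol _ hy'
  have hlj : l < j := by omega
  refine ⟨l, by omega, p, ?_, ?_⟩
  · simp only [hlj, dite_true]; exact hp
  · have h1 := tdist_le_of_mem_plaqCover_toFine (l := l) (by omega) hc
    have hLl : (P.L : ℝ) ^ l ≤ (P.L : ℝ) ^ i :=
      pow_le_pow_right₀ (by exact_mod_cast P.hL.2.le) (by omega)
    have h2 : (Site.tdist c (toFine l p.src) : ℝ) ≤ (2 + P.d) * (P.L : ℝ) ^ i :=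
      h1.trans (mul_le_mul_of_nonneg_left hLl (by positivity))
    have htri : (Site.tdist (toFine i y) (toFine l p.src) : ℝ) ≤ Site.tdist c (toFine i y) + Site.tdist c (toFine l p.src) := by
      have := tdist_triangle (toFine i y) c (toFine l p.src)
      rw [tdist_comm (toFine i y) c] at this
      exact_mod_cast this
    have hreal : (Site.tdist (toFine i y) (toFine l p.src) : ℝ) ≤ ρ := by linarith
    exact_mod_cast hreal

end Summit.QuantumFields.YangMills.Theorems.HistoryTailZCount

end
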